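import Mathlib
import Summits.PneNP.PneNP.Theorems.ClusUniversalCertificateLayerFracDefs
import Summits.PneNP.PneNP.Theorems.ClusUniversalCertificateLayerStep

/-!
# Route ClusUniversalCertificate, crux `UniversalCertAll` — line `layer`: registered stub `stub_fracLayerStep`

Stub file for `stmt-PneNP-19683` (cell pnp-ideate, route `ClusUniversalCertificate`, rung F-N1; line `layer` of
pnp-ideate-p1, skeleton v5 sha16 12a0894d3a91): **`stub_fracLayerStep : FracLayerStepAll`** — the induction step of the
one-block induction for FRACTIONAL layer families (members `S` with nonnegative rational weights `w_S`, `Σ_S w_S 1_S = f`).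
Pure bookkeeping, the weighted re-run of the landed `ClusLayer.stub_layerStep`:

* WEIGHTED DOUBLE COUNTING (`sum_weight_card_filter_frac`): for every property `P` of points one block down,
  `Σ_{(S,w) ∈ L} w·#{x ∈ S : P x} = #{y ∈ Y : P (π y)}`, `π = Fin.removeNth k` (swap the list sum with the finite sum over
  points, then the weighted multiplicity and `Finset.card_eq_sum_card_fiberwise`); with `P = ⊤`: `Σ w_S |S| = |Y|`; with
  `P = (· j = 0)`: `Σ w_S Z_j(S) = Z_{k.succAbove j}(Y)`;
* the members' `n`-block certificates, weighted by `w_S ≥ 0` and summed, the fractional layer inequality (in `ℚ`),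
  `ClusLayerStep.dimSum_eq` and `Fin.sum_univ_succAbove` give the `(n+1)`-block certificate of `Y`, cast back to `ℤ`.

FRONTIER rung F-N1 (a combinatorial certificate about affine flats in `(𝔽₂^m)^n`); the line's conjecture
(`LayerLemmaFrom3` / `FracLayerLemmaFrom3`) is OPEN and nothing here bears on P vs NP.
-/

set_option linter.dupNamespace false -- `Summit.PneNP.PneNP.…`: summit = sub-problem name (D-0017 single-conjunct layout)

namespace Summit.PneNP.PneNP.Theorems.ClusLayerFracStep

open Finset
open Summit.PneNP.PneNP.Theorems.ClusSkew (codimY)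
open Summit.PneNP.PneNP.Theorems.ClusLayer (dimSum UCIneq IsFracLayerFamily FracLayerIneq FracLayerStepAll)
open Summit.PneNP.PneNP.Theorems.ClusLayerStep (dimSum_eq)

variable {n m : ℕ}

/-! ## List sums in `ℚ` -/

/-- A list sum of finite sums is the finite sum of the list sums. -/
theorem list_sum_map_finset_sum {α β : Type} (L : List α) (U : Finset β) (g : α → β → ℚ) :
    (L.map fun p => ∑ x ∈ U, g p x).sum = ∑ x ∈ U, (L.map fun p => g p x).sum := by
  induction L with
  | nil => simp
  | cons p L ih => simp only [List.map_cons, List.sum_cons, Finset.sum_add_distrib, ih]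

/-- Pointwise comparison of list sums. -/
theorem list_sum_map_le {α : Type} (L : List α) (f g : α → ℚ) (h : ∀ p ∈ L, f p ≤ g p) :
    (L.map f).sum ≤ (L.map g).sum := by
  induction L with
  | nil => simp
  | cons p L ih =>
    simp only [List.map_cons, List.sum_cons]
    exact add_le_add (h p (by simp)) (ih fun q hq => h q (by simp [hq]))

/-- List sums of sums. -/
theorem list_sum_map_add {α : Type} (L : List α) (f g : α → ℚ) :
    (L.map fun p => f p + g p).sum = (L.map f).sum + (L.map g).sum := by
  induction L with
  | nil => simp
  | cons p L ih => simp only [List.map_cons, List.sum_cons, ih]; ring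

/-- List sums of scalar multiples. -/
theorem list_sum_map_mul {α : Type} (L : List α) (c : ℚ) (f : α → ℚ) :
    (L.map fun p => c * f p).sum = c * (L.map f).sum := by
  induction L with
  | nil => simp
  | cons p L ih => simp only [List.map_cons, List.sum_cons, ih]; ring

/-! ## Weighted double counting through a fractional layer family -/

/-- **Weighted double counting.** For a fractional layer family `L` of `(Y, k)` and any property `P` of points one block
down, `Σ_{(S,w) ∈ L} w · #{x ∈ S : P x} = #{y ∈ Y : P (π y)}` with `π = Fin.removeNth k`. -/
theorem sum_weight_card_filter_frac (Y : Finset (Fin (n + 1) → Fin m → ZMod 2)) (k : Fin (n + 1))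
    (L : List (Finset (Fin n → Fin m → ZMod 2) × ℚ)) (hL : IsFracLayerFamily m Y k L)
    (P : (Fin n → Fin m → ZMod 2) → Prop) [DecidablePred P] :
    (L.map fun p => p.2 * ((p.1.filter P).card : ℚ)).sum =
      ((Y.filter fun y => P (Fin.removeNth k y)).card : ℚ) := by
  -- each member's weighted count as a sum of weighted indicators over the points satisfying `P`
  have hS : ∀ p : Finset (Fin n → Fin m → ZMod 2) × ℚ,
      p.2 * ((p.1.filter P).card : ℚ) = ∑ x ∈ univ.filter P, (if x ∈ p.1 then p.2 else 0) := by
    intro p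
    have h1 : ((p.1.filter P).card : ℚ) = ∑ x ∈ univ.filter P, (if x ∈ p.1 then (1 : ℚ) else 0) := by
      rw [Finset.sum_ite_mem, Finset.card_eq_sum_ones, Nat.cast_sum]
      simp only [Nat.cast_one]
      congr 1
      ext x
      simp [and_comm]
    rw [h1, Finset.mul_sum]
    refine Finset.sum_congr rfl fun x _ => ?_
    split_ifs <;> simp
  simp_rw [hS]
  rw [list_sum_map_finset_sum]
  simp_rw [hL.2]
  -- fibrewise count of `Y.filter (P ∘ π)` along `π`
  rw [Finset.card_eq_sum_card_fiberwise (f := fun y => Fin.removeNth k y) (s := Y.filter fun y => P (Fin.removeNth k y))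
    (t := univ.filter P) (fun y hy => Finset.mem_filter.2 ⟨Finset.mem_univ _, (Finset.mem_filter.1 hy).2⟩)]
  push_cast
  refine Finset.sum_congr rfl fun x hx => ?_
  have hPx : P x := (Finset.mem_filter.1 hx).2
  congr 2
  ext y
  simp only [Finset.mem_filter]
  constructor
  · rintro ⟨hy, hyx⟩; exact ⟨⟨hy, hyx ▸ hPx⟩, hyx⟩
  · rintro ⟨⟨hy, -⟩, hyx⟩; exact ⟨hy, hyx⟩

/-- `Σ w_S |S| = |Y|`. -/
theorem sum_weight_card_frac (Y : Finset (Fin (n + 1) → Fin m → ZMod 2)) (k : Fin (n + 1))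
    (L : List (Finset (Fin n → Fin m → ZMod 2) × ℚ)) (hL : IsFracLayerFamily m Y k L) :
    (L.map fun p => p.2 * (p.1.card : ℚ)).sum = (Y.card : ℚ) := by
  have h := sum_weight_card_filter_frac Y k L hL (fun _ => True)
  simp only [Finset.filter_true_of_mem (fun _ _ => trivial)] at h
  exact h

/-- `Σ w_S Z_j(S) = Z_{k.succAbove j}(Y)`. -/
theorem sum_weight_zero_frac (Y : Finset (Fin (n + 1) → Fin m → ZMod 2)) (k : Fin (n + 1))
    (L : List (Finset (Fin n → Fin m → ZMod 2) × ℚ)) (hL : IsFracLayerFamily m Y k L) (j : Fin n) :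
    (L.map fun p => p.2 * ((p.1.filter fun x => x j = 0).card : ℚ)).sum =
      ((Y.filter fun y => y (k.succAbove j) = 0).card : ℚ) :=
  sum_weight_card_filter_frac Y k L hL (fun x => x j = 0)

end Summit.PneNP.PneNP.Theorems.ClusLayerFracStep

namespace Summit.PneNP.PneNP.Theorems.ClusLayer

open Finset
open Summit.PneNP.PneNP.Theorems.ClusSkew (codimY)
open Summit.PneNP.PneNP.Theorems.ClusLayerStep (dimSum_eq)
open Summit.PneNP.PneNP.Theorems.ClusLayerFracStep

/-- **Registered stub `stub_fracLayerStep` of the line `layer`** (stmt-PneNP-19683, skeleton v5): the induction step for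
fractional layer families — the weighted members' `n`-block certificates and the fractional layer inequality give the
`(n + 1)`-block certificate (pure bookkeeping: `Σ w_S|S| = |Y|`, `Σ w_S Z_j(S) = Z_{k.succAbove j}(Y)`,
`(n·m − codim) − n(m−1) = n − codim`, `Fin.sum_univ_succAbove`; inequalities in `ℚ`, cast back to `ℤ`). -/
theorem stub_fracLayerStep : FracLayerStepAll := by
  intro n m Y k L hfam hineq hmem
  unfold FracLayerIneq at hineq
  -- the members' certificates, in `ℚ`
  have hmem' : ∀ p ∈ L, p.2 * (dimSum m p.1 : ℚ) ≤
      p.2 * ((2 : ℚ) ^ m * (∑ j : Fin n, ((p.1.filter fun x => x j = 0).card : ℚ)) +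
        (n : ℚ) * ((m : ℚ) - 1) * (p.1.card : ℚ)) := by
    intro p hp
    have h := hmem p hp
    unfold UCIneq at h
    rw [← Finset.mul_sum] at h
    have hq : ((dimSum m p.1 : ℤ) : ℚ) ≤
        (2 : ℚ) ^ m * (∑ j : Fin n, ((p.1.filter fun x => x j = 0).card : ℚ)) +
          (n : ℚ) * ((m : ℚ) - 1) * (p.1.card : ℚ) := by
      rw [dimSum_eq]
      push_cast
      have h' : ((∑ x ∈ p.1, ((n : ℤ) - (codimY m p.1 x : ℤ)) : ℤ) : ℚ) ≤
          (((2 : ℤ) ^ m * ∑ j : Fin n, ((p.1.filter fun x => x j = 0).card : ℤ) : ℤ) : ℚ) := by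
        exact_mod_cast h
      push_cast at h'
      linarith
    exact mul_le_mul_of_nonneg_left hq (hfam.1 p hp)
  have hsumD : (L.map fun p => p.2 * (dimSum m p.1 : ℚ)).sum ≤
      (2 : ℚ) ^ m * (∑ j : Fin n, ((Y.filter fun y => y (k.succAbove j) = 0).card : ℚ)) +
        (n : ℚ) * ((m : ℚ) - 1) * (Y.card : ℚ) := by
    refine (list_sum_map_le L _ _ hmem').trans (le_of_eq ?_)
    have hsplit : ∀ p : Finset (Fin n → Fin m → ZMod 2) × ℚ,
        p.2 * ((2 : ℚ) ^ m * (∑ j : Fin n, ((p.1.filter fun x => x j = 0).card : ℚ)) +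
          (n : ℚ) * ((m : ℚ) - 1) * (p.1.card : ℚ)) =
        (2 : ℚ) ^ m * (∑ j : Fin n, p.2 * ((p.1.filter fun x => x j = 0).card : ℚ)) +
          (n : ℚ) * ((m : ℚ) - 1) * (p.2 * (p.1.card : ℚ)) := by
      intro p
      rw [← Finset.mul_sum]
      ring
    simp_rw [hsplit]
    rw [list_sum_map_add, list_sum_map_mul, list_sum_map_mul, sum_weight_card_frac Y k L hfam]
    congr 2
    rw [list_sum_map_finset_sum]
    exact Finset.sum_congr rfl fun j _ => sum_weight_zero_frac Y k L hfam j
  -- `D(Y)` against the goal's left-hand side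
  have hDY : (dimSum m Y : ℚ) = ((∑ y ∈ Y, (((n + 1 : ℕ) : ℤ) - (codimY m Y y : ℤ)) : ℤ) : ℚ) +
      ((n : ℚ) + 1) * ((m : ℚ) - 1) * (Y.card : ℚ) := by
    rw [dimSum_eq]; push_cast; ring
  -- conclude in `ℚ`, then cast
  unfold UCIneq
  have key : ((∑ y ∈ Y, (((n + 1 : ℕ) : ℤ) - (codimY m Y y : ℤ)) : ℤ) : ℚ) ≤
      ((∑ i : Fin (n + 1), (2 : ℤ) ^ m * ((Y.filter fun y => y i = 0).card : ℤ) : ℤ) : ℚ) := by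
    rw [Fin.sum_univ_succAbove _ k]
    push_cast
    have hfac : ∑ i : Fin n, (2 : ℚ) ^ m * ((Y.filter fun y => y (k.succAbove i) = 0).card : ℚ) =
        (2 : ℚ) ^ m * ∑ i : Fin n, ((Y.filter fun y => y (k.succAbove i) = 0).card : ℚ) :=
      (Finset.mul_sum _ _ _).symm
    have hDY' : (dimSum m Y : ℚ) = (∑ y ∈ Y, (((n : ℚ) + 1) - (codimY m Y y : ℚ))) +
        ((n : ℚ) + 1) * ((m : ℚ) - 1) * (Y.card : ℚ) := by
      rw [hDY]; push_cast; ring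
    linarith
  exact_mod_cast key

end Summit.PneNP.PneNP.Theorems.ClusLayer
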